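import Literature.Probability.Percolation.DecisionTreeWeighted
import Summits.CriticalPhenomena.PercolationContinuityZ3.Theorems.PercNearOneGluingNoHeavyLowerTailAPLGluedClusters
import HarnessLib

/-!
# `NoHeavyLowerTail` (stmt-CriticalPhenomena-4575) — the graph ↔ cells dictionary, II: the cells of a glued edge set are the apex piece-union of the pieces' cells

Support file (prover prim-ineq-gen-8 gen 36; `--supports stmt-CriticalPhenomena-4575`; memo
run/shared/lean/prim/prim-ineq-gen-8/FINDING-gen36-LEMMA-U.md §4, step (D1)(i),(iii)).  No definitions, no named facts, no sorries.

SETTING.  Weights `p : Sym2 V → ℝ` on a finite vertex type, disjoint edge sets `D₁, D₂ : Finset (Sym2 V)` GLUED AT THE TERMINALS `a, b, c`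
(no vertex outside `{a,b,c}` meets both), and the five cells of the instance `(a; b, c)` on an edge set `D` written as finite weighted
probabilities `DecisionTree.PrW D p {K | …}` of the cluster events (`Gladkov.cl`):
`u0 = P(a|b|c)`, `uab = P(ab|c)`, `uac = P(ac|b)`, `ubc = P(a|bc)`, `u3 = P(abc)` (for `prodBernoulli` these are the cell probabilities, by
`DecisionTree.prodBernoulli_real_eq_PrW`).
* `wtW_glue`, `PrW_glue_sum` — product structure of the weights over `D₁ ∪ D₂` (disjoint): `P_{D₁∪D₂}(X) = Σ_{S₁⊆D₁} Σ_{S₂⊆D₂} w₁(S₁)w₂(S₂)·1[S₁∪S₂ ∈ X]`.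
* `cl_cell_cases` — the three cluster relations among `a, b, c` form one of the five partitions.
* `glued_ind_zero/ab/ac/bc/three` — pointwise: by the join formulas of `…APLGluedClusters.lean`, the indicator of each cell at `S₁ ∪ S₂` is the
  sum over the pairs of piece cells whose join is that cell (1, 3, 3, 3, 15 pairs).
* `glued_cell_zero/ab/ac/bc/three` — **THE UNION LEMMA** (memo gen 34 §2, "the cell vector of a glued graph is the apex piece-union of the
  pieces' cell vectors"): `w0 = u0·v0`, `wab = u0·vab + uab·v0 + uab·vab`, `wac`, `wbc` likewise, `w3` = the remaining 15 products — exactly the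
  union cells of `…APLConjF*.lean` (there `w3` is written `u3S_v + S_uv3 − u3v3 + …`, equal to the 15-product form since the cells sum to the mass).
With `region_union` (`…APLUnionClosure.lean`) this is the induction step of THEOREM F_T at the level of finite weighted graphs; the pendant and
connector steps and the assembly remain (memo §4 (D2)–(D4)). [folklore]
-/

namespace Summit.CriticalPhenomena.PercolationContinuityZ3.Theorems

namespace APL

open Literature.Probability.Percolation Literature.Probability.Percolation.Gladkov Literature.Probability.Percolation.DecisionTree
open scoped Classical

section Weights

variable {ι : Type*} [DecidableEq ι]

/-- Product structure of the configuration weights over a disjoint union of coordinate sets. [folklore] -/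
theorem wtW_glue (p : ι → ℝ) {D₁ D₂ : Finset ι} (hdisj : Disjoint D₁ D₂) {S₁ S₂ : Finset ι} (hS₁ : S₁ ⊆ D₁) (hS₂ : S₂ ⊆ D₂) :
    wtW (D₁ ∪ D₂) p (S₁ ∪ S₂) = wtW D₁ p S₁ * wtW D₂ p S₂ := by
  unfold wtW
  rw [Finset.prod_union hdisj]
  congr 1
  · refine Finset.prod_congr rfl fun i hi => ?_
    have : i ∈ S₁ ∪ S₂ ↔ i ∈ S₁ := by
      rw [Finset.mem_union]
      exact ⟨fun h => h.elim id fun h2 => absurd (hS₂ h2) (Finset.disjoint_left.1 hdisj hi), Or.inl⟩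
    simp only [this]
  · refine Finset.prod_congr rfl fun i hi => ?_
    have : i ∈ S₁ ∪ S₂ ↔ i ∈ S₂ := by
      rw [Finset.mem_union]
      exact ⟨fun h => h.elim (fun h1 => absurd hi (Finset.disjoint_left.1 hdisj (hS₁ h1))) id, Or.inr⟩
    simp only [this]

/-- **Gluing formula for `PrW`**: over a disjoint union of coordinate sets the finite weighted probability is a double sum with product
weights. [folklore] -/
theorem PrW_glue_sum (p : ι → ℝ) {D₁ D₂ : Finset ι} (hdisj : Disjoint D₁ D₂) (X : Set (Finset ι)) :
    PrW (D₁ ∪ D₂) p X = ∑ S₁ ∈ D₁.powerset, ∑ S₂ ∈ D₂.powerset, wtW D₁ p S₁ * wtW D₂ p S₂ * ind X (S₁ ∪ S₂) := by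
  rw [PrW_eq_sum_ind, ← Finset.sum_product']
  symm
  refine Finset.sum_nbij' (fun x => x.1 ∪ x.2) (fun S => (S ∩ D₁, S ∩ D₂)) ?_ ?_ ?_ ?_ ?_
  · intro x hx
    rw [Finset.mem_product, Finset.mem_powerset, Finset.mem_powerset] at hx
    exact Finset.mem_powerset.2 (Finset.union_subset_union hx.1 hx.2)
  · intro S hS
    rw [Finset.mem_powerset] at hS
    exact Finset.mem_product.2 ⟨Finset.mem_powerset.2 Finset.inter_subset_right, Finset.mem_powerset.2 Finset.inter_subset_right⟩
  · intro x hx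
    rw [Finset.mem_product, Finset.mem_powerset, Finset.mem_powerset] at hx
    obtain ⟨h1, h2⟩ := hx
    have e1 : (x.1 ∪ x.2) ∩ D₁ = x.1 := by
      rw [Finset.union_inter_distrib_right, Finset.inter_eq_left.2 h1]
      have : x.2 ∩ D₁ = ∅ := Finset.disjoint_iff_inter_eq_empty.1 (Finset.disjoint_of_subset_left h2 hdisj.symm)
      rw [this, Finset.union_empty]
    have e2 : (x.1 ∪ x.2) ∩ D₂ = x.2 := by
      rw [Finset.union_inter_distrib_right, Finset.inter_eq_left.2 h2]
      have : x.1 ∩ D₂ = ∅ := Finset.disjoint_iff_inter_eq_empty.1 (Finset.disjoint_of_subset_left h1 hdisj)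
      rw [this, Finset.empty_union]
    exact Prod.ext e1 e2
  · intro S hS
    rw [Finset.mem_powerset] at hS
    show S ∩ D₁ ∪ S ∩ D₂ = S
    rw [← Finset.inter_union_distrib_left, Finset.inter_eq_left.2 hS]
  · intro x hx
    rw [Finset.mem_product, Finset.mem_powerset, Finset.mem_powerset] at hx
    show wtW D₁ p x.1 * wtW D₂ p x.2 * ind X (x.1 ∪ x.2) = wtW (D₁ ∪ D₂) p (x.1 ∪ x.2) * ind X (x.1 ∪ x.2)
    rw [wtW_glue p hdisj hx.1 hx.2]

end Weights

variable {V : Type*} [Fintype V] [DecidableEq V]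

omit [DecidableEq V] in
/-- The three cluster relations among `a, b, c` in a configuration realise one of the five partitions of `{a,b,c}`
(transitivity of `cl` rules out the other three patterns). [folklore] -/
theorem cl_cell_cases (S : Finset (Sym2 V)) (a b c : V) :
    (b ∉ cl S a ∧ c ∉ cl S a ∧ c ∉ cl S b) ∨ (b ∈ cl S a ∧ c ∉ cl S a ∧ c ∉ cl S b) ∨ (c ∈ cl S a ∧ b ∉ cl S a ∧ c ∉ cl S b) ∨
      (b ∉ cl S a ∧ c ∉ cl S a ∧ c ∈ cl S b) ∨ (b ∈ cl S a ∧ c ∈ cl S a ∧ c ∈ cl S b) := by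
  by_cases hab : b ∈ cl S a <;> by_cases hac : c ∈ cl S a <;> by_cases hbc : c ∈ cl S b
  · exact Or.inr (Or.inr (Or.inr (Or.inr ⟨hab, hac, hbc⟩)))
  · exact absurd (ThreePointLB.mem_cl_trans (mem_cl_comm.1 hab) hac) hbc
  · exact absurd (ThreePointLB.mem_cl_trans hab hbc) hac
  · exact Or.inr (Or.inl ⟨hab, hac, hbc⟩)
  · exact absurd (ThreePointLB.mem_cl_trans hac (mem_cl_comm.1 hbc)) hab
  · exact Or.inr (Or.inr (Or.inl ⟨hac, hab, hbc⟩))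
  · exact Or.inr (Or.inr (Or.inr (Or.inl ⟨hab, hac, hbc⟩)))
  · exact Or.inl ⟨hab, hac, hbc⟩

/-- Pointwise join bookkeeping for the union cell `a|b|c`: its indicator at `S₁ ∪ S₂` is the sum over the 1 pair(s) of piece cells
whose join is `a|b|c`. [folklore] -/
theorem glued_ind_zero (S₁ S₂ : Finset (Sym2 V)) (a b c : V)
    (hsep : ∀ v : V, (∃ e ∈ S₁, v ∈ e) → (∃ e ∈ S₂, v ∈ e) → (v = a ∨ v = b ∨ v = c)) :
    ind {K : Finset (Sym2 V) | b ∉ cl K a ∧ c ∉ cl K a ∧ c ∉ cl K b} (S₁ ∪ S₂)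
      = ind {K : Finset (Sym2 V) | b ∉ cl K a ∧ c ∉ cl K a ∧ c ∉ cl K b} S₁ * ind {K : Finset (Sym2 V) | b ∉ cl K a ∧ c ∉ cl K a ∧ c ∉ cl K b} S₂ := by
  have hab := glued_ab_iff S₁ S₂ a b c hsep
  have hac := glued_ac_iff S₁ S₂ a b c hsep
  have hbc := glued_bc_iff S₁ S₂ a b c hsep
  have e1 : (b ∈ cl S₁ c) = (c ∈ cl S₁ b) := propext mem_cl_comm
  have e2 : (b ∈ cl S₂ c) = (c ∈ cl S₂ b) := propext mem_cl_comm
  rw [e1, e2] at hab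
  rcases cl_cell_cases S₁ a b c with ⟨h1, h2, h3⟩ | ⟨h1, h2, h3⟩ | ⟨h1, h2, h3⟩ | ⟨h1, h2, h3⟩ | ⟨h1, h2, h3⟩ <;>
  rcases cl_cell_cases S₂ a b c with ⟨k1, k2, k3⟩ | ⟨k1, k2, k3⟩ | ⟨k1, k2, k3⟩ | ⟨k1, k2, k3⟩ | ⟨k1, k2, k3⟩ <;>
  simp [ind, Set.mem_setOf_eq, hab, hac, hbc, h1, h2, h3, k1, k2, k3]

/-- Pointwise join bookkeeping for the union cell `ab|c`: its indicator at `S₁ ∪ S₂` is the sum over the 3 pair(s) of piece cells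
whose join is `ab|c`. [folklore] -/
theorem glued_ind_ab (S₁ S₂ : Finset (Sym2 V)) (a b c : V)
    (hsep : ∀ v : V, (∃ e ∈ S₁, v ∈ e) → (∃ e ∈ S₂, v ∈ e) → (v = a ∨ v = b ∨ v = c)) :
    ind {K : Finset (Sym2 V) | b ∈ cl K a ∧ c ∉ cl K a} (S₁ ∪ S₂)
      = ind {K : Finset (Sym2 V) | b ∉ cl K a ∧ c ∉ cl K a ∧ c ∉ cl K b} S₁ * ind {K : Finset (Sym2 V) | b ∈ cl K a ∧ c ∉ cl K a} S₂ + ind {K : Finset (Sym2 V) | b ∈ cl K a ∧ c ∉ cl K a} S₁ * ind {K : Finset (Sym2 V) | b ∉ cl K a ∧ c ∉ cl K a ∧ c ∉ cl K b} S₂ + ind {K : Finset (Sym2 V) | b ∈ cl K a ∧ c ∉ cl K a} S₁ * ind {K : Finset (Sym2 V) | b ∈ cl K a ∧ c ∉ cl K a} S₂ := by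
  have hab := glued_ab_iff S₁ S₂ a b c hsep
  have hac := glued_ac_iff S₁ S₂ a b c hsep
  have e1 : (b ∈ cl S₁ c) = (c ∈ cl S₁ b) := propext mem_cl_comm
  have e2 : (b ∈ cl S₂ c) = (c ∈ cl S₂ b) := propext mem_cl_comm
  rw [e1, e2] at hab
  rcases cl_cell_cases S₁ a b c with ⟨h1, h2, h3⟩ | ⟨h1, h2, h3⟩ | ⟨h1, h2, h3⟩ | ⟨h1, h2, h3⟩ | ⟨h1, h2, h3⟩ <;>
  rcases cl_cell_cases S₂ a b c with ⟨k1, k2, k3⟩ | ⟨k1, k2, k3⟩ | ⟨k1, k2, k3⟩ | ⟨k1, k2, k3⟩ | ⟨k1, k2, k3⟩ <;>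
  simp [ind, Set.mem_setOf_eq, hab, hac, h1, h2, h3, k1, k2, k3]

/-- Pointwise join bookkeeping for the union cell `ac|b`: its indicator at `S₁ ∪ S₂` is the sum over the 3 pair(s) of piece cells
whose join is `ac|b`. [folklore] -/
theorem glued_ind_ac (S₁ S₂ : Finset (Sym2 V)) (a b c : V)
    (hsep : ∀ v : V, (∃ e ∈ S₁, v ∈ e) → (∃ e ∈ S₂, v ∈ e) → (v = a ∨ v = b ∨ v = c)) :
    ind {K : Finset (Sym2 V) | c ∈ cl K a ∧ b ∉ cl K a} (S₁ ∪ S₂)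
      = ind {K : Finset (Sym2 V) | b ∉ cl K a ∧ c ∉ cl K a ∧ c ∉ cl K b} S₁ * ind {K : Finset (Sym2 V) | c ∈ cl K a ∧ b ∉ cl K a} S₂ + ind {K : Finset (Sym2 V) | c ∈ cl K a ∧ b ∉ cl K a} S₁ * ind {K : Finset (Sym2 V) | b ∉ cl K a ∧ c ∉ cl K a ∧ c ∉ cl K b} S₂ + ind {K : Finset (Sym2 V) | c ∈ cl K a ∧ b ∉ cl K a} S₁ * ind {K : Finset (Sym2 V) | c ∈ cl K a ∧ b ∉ cl K a} S₂ := by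
  have hab := glued_ab_iff S₁ S₂ a b c hsep
  have hac := glued_ac_iff S₁ S₂ a b c hsep
  have e1 : (b ∈ cl S₁ c) = (c ∈ cl S₁ b) := propext mem_cl_comm
  have e2 : (b ∈ cl S₂ c) = (c ∈ cl S₂ b) := propext mem_cl_comm
  rw [e1, e2] at hab
  rcases cl_cell_cases S₁ a b c with ⟨h1, h2, h3⟩ | ⟨h1, h2, h3⟩ | ⟨h1, h2, h3⟩ | ⟨h1, h2, h3⟩ | ⟨h1, h2, h3⟩ <;>
  rcases cl_cell_cases S₂ a b c with ⟨k1, k2, k3⟩ | ⟨k1, k2, k3⟩ | ⟨k1, k2, k3⟩ | ⟨k1, k2, k3⟩ | ⟨k1, k2, k3⟩ <;>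
  simp [ind, Set.mem_setOf_eq, hab, hac, h1, h2, h3, k1, k2, k3]

/-- Pointwise join bookkeeping for the union cell `a|bc`: its indicator at `S₁ ∪ S₂` is the sum over the 3 pair(s) of piece cells
whose join is `a|bc`. [folklore] -/
theorem glued_ind_bc (S₁ S₂ : Finset (Sym2 V)) (a b c : V)
    (hsep : ∀ v : V, (∃ e ∈ S₁, v ∈ e) → (∃ e ∈ S₂, v ∈ e) → (v = a ∨ v = b ∨ v = c)) :
    ind {K : Finset (Sym2 V) | b ∉ cl K a ∧ c ∉ cl K a ∧ c ∈ cl K b} (S₁ ∪ S₂)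
      = ind {K : Finset (Sym2 V) | b ∉ cl K a ∧ c ∉ cl K a ∧ c ∉ cl K b} S₁ * ind {K : Finset (Sym2 V) | b ∉ cl K a ∧ c ∉ cl K a ∧ c ∈ cl K b} S₂ + ind {K : Finset (Sym2 V) | b ∉ cl K a ∧ c ∉ cl K a ∧ c ∈ cl K b} S₁ * ind {K : Finset (Sym2 V) | b ∉ cl K a ∧ c ∉ cl K a ∧ c ∉ cl K b} S₂ + ind {K : Finset (Sym2 V) | b ∉ cl K a ∧ c ∉ cl K a ∧ c ∈ cl K b} S₁ * ind {K : Finset (Sym2 V) | b ∉ cl K a ∧ c ∉ cl K a ∧ c ∈ cl K b} S₂ := by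
  have hab := glued_ab_iff S₁ S₂ a b c hsep
  have hac := glued_ac_iff S₁ S₂ a b c hsep
  have hbc := glued_bc_iff S₁ S₂ a b c hsep
  have e1 : (b ∈ cl S₁ c) = (c ∈ cl S₁ b) := propext mem_cl_comm
  have e2 : (b ∈ cl S₂ c) = (c ∈ cl S₂ b) := propext mem_cl_comm
  rw [e1, e2] at hab
  rcases cl_cell_cases S₁ a b c with ⟨h1, h2, h3⟩ | ⟨h1, h2, h3⟩ | ⟨h1, h2, h3⟩ | ⟨h1, h2, h3⟩ | ⟨h1, h2, h3⟩ <;>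
  rcases cl_cell_cases S₂ a b c with ⟨k1, k2, k3⟩ | ⟨k1, k2, k3⟩ | ⟨k1, k2, k3⟩ | ⟨k1, k2, k3⟩ | ⟨k1, k2, k3⟩ <;>
  simp [ind, Set.mem_setOf_eq, hab, hac, hbc, h1, h2, h3, k1, k2, k3]

/-- Pointwise join bookkeeping for the union cell `abc`: its indicator at `S₁ ∪ S₂` is the sum over the 15 pair(s) of piece cells
whose join is `abc`. [folklore] -/
theorem glued_ind_three (S₁ S₂ : Finset (Sym2 V)) (a b c : V)
    (hsep : ∀ v : V, (∃ e ∈ S₁, v ∈ e) → (∃ e ∈ S₂, v ∈ e) → (v = a ∨ v = b ∨ v = c)) :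
    ind {K : Finset (Sym2 V) | b ∈ cl K a ∧ c ∈ cl K a} (S₁ ∪ S₂)
      = ind {K : Finset (Sym2 V) | b ∉ cl K a ∧ c ∉ cl K a ∧ c ∉ cl K b} S₁ * ind {K : Finset (Sym2 V) | b ∈ cl K a ∧ c ∈ cl K a} S₂ + ind {K : Finset (Sym2 V) | b ∈ cl K a ∧ c ∉ cl K a} S₁ * ind {K : Finset (Sym2 V) | c ∈ cl K a ∧ b ∉ cl K a} S₂ + ind {K : Finset (Sym2 V) | b ∈ cl K a ∧ c ∉ cl K a} S₁ * ind {K : Finset (Sym2 V) | b ∉ cl K a ∧ c ∉ cl K a ∧ c ∈ cl K b} S₂ + ind {K : Finset (Sym2 V) | b ∈ cl K a ∧ c ∉ cl K a} S₁ * ind {K : Finset (Sym2 V) | b ∈ cl K a ∧ c ∈ cl K a} S₂ + ind {K : Finset (Sym2 V) | c ∈ cl K a ∧ b ∉ cl K a} S₁ * ind {K : Finset (Sym2 V) | b ∈ cl K a ∧ c ∉ cl K a} S₂ + ind {K : Finset (Sym2 V) | c ∈ cl K a ∧ b ∉ cl K a} S₁ * ind {K : Finset (Sym2 V) | b ∉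 cl K a ∧ c ∉ cl K a ∧ c ∈ cl K b} S₂ + ind {K : Finset (Sym2 V) | c ∈ cl K a ∧ b ∉ cl K a} S₁ * ind {K : Finset (Sym2 V) | b ∈ cl K a ∧ c ∈ cl K a} S₂ + ind {K : Finset (Sym2 V) | b ∉ cl K a ∧ c ∉ cl K a ∧ c ∈ cl K b} S₁ * ind {K : Finset (Sym2 V) | b ∈ cl K a ∧ c ∉ cl K a} S₂ + ind {K : Finset (Sym2 V) | b ∉ cl K a ∧ c ∉ cl K a ∧ c ∈ cl K b} S₁ * ind {K : Finset (Sym2 V) | c ∈ cl K a ∧ b ∉ cl K a} S₂ + ind {K : Finset (Sym2 V) | b ∉ cl K a ∧ c ∉ cl K a ∧ c ∈ cl K b} S₁ * ind {K : Finset (Sym2 V) | b ∈ cl K a ∧ c ∈ cl K a} S₂ + ind {K : Finset (Sym2 V) | b ∈ cl K a ∧ c ∈ cl K a} S₁ * ind {K : Finset (Sym2 V) | b ∉ cl K a ∧ c ∉ cl K a ∧ c ∉ cl K b} S₂ + ind {K : Finset (Sym2 V) | b ∈ cl K a ∧ c ∈ cl K a} S₁ * ind {K : Finset (Sym2 V)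 | b ∈ cl K a ∧ c ∉ cl K a} S₂ + ind {K : Finset (Sym2 V) | b ∈ cl K a ∧ c ∈ cl K a} S₁ * ind {K : Finset (Sym2 V) | c ∈ cl K a ∧ b ∉ cl K a} S₂ + ind {K : Finset (Sym2 V) | b ∈ cl K a ∧ c ∈ cl K a} S₁ * ind {K : Finset (Sym2 V) | b ∉ cl K a ∧ c ∉ cl K a ∧ c ∈ cl K b} S₂ + ind {K : Finset (Sym2 V) | b ∈ cl K a ∧ c ∈ cl K a} S₁ * ind {K : Finset (Sym2 V) | b ∈ cl K a ∧ c ∈ cl K a} S₂ := by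
  have hab := glued_ab_iff S₁ S₂ a b c hsep
  have hac := glued_ac_iff S₁ S₂ a b c hsep
  have e1 : (b ∈ cl S₁ c) = (c ∈ cl S₁ b) := propext mem_cl_comm
  have e2 : (b ∈ cl S₂ c) = (c ∈ cl S₂ b) := propext mem_cl_comm
  rw [e1, e2] at hab
  rcases cl_cell_cases S₁ a b c with ⟨h1, h2, h3⟩ | ⟨h1, h2, h3⟩ | ⟨h1, h2, h3⟩ | ⟨h1, h2, h3⟩ | ⟨h1, h2, h3⟩ <;>
  rcases cl_cell_cases S₂ a b c with ⟨k1, k2, k3⟩ | ⟨k1, k2, k3⟩ | ⟨k1, k2, k3⟩ | ⟨k1, k2, k3⟩ | ⟨k1, k2, k3⟩ <;>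
  simp [ind, Set.mem_setOf_eq, hab, hac, h1, h2, h3, k1, k2, k3]


/-- **Union lemma, cell `a|b|c`.**  For disjoint edge sets `D₁, D₂` glued only at the terminals, the `a|b|c`-cell of `(a; b, c)` on
`D₁ ∪ D₂` is the apex piece-union polynomial of the pieces' cells (1 product(s)). [folklore] -/
theorem glued_cell_zero (p : Sym2 V → ℝ) (D₁ D₂ : Finset (Sym2 V)) (hdisj : Disjoint D₁ D₂) (a b c : V)
    (hsep : ∀ v : V, (∃ e ∈ D₁, v ∈ e) → (∃ e ∈ D₂, v ∈ e) → (v = a ∨ v = b ∨ v = c)) :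
    PrW (D₁ ∪ D₂) p {K : Finset (Sym2 V) | b ∉ cl K a ∧ c ∉ cl K a ∧ c ∉ cl K b}
      = PrW D₁ p {K : Finset (Sym2 V) | b ∉ cl K a ∧ c ∉ cl K a ∧ c ∉ cl K b} * PrW D₂ p {K : Finset (Sym2 V) | b ∉ cl K a ∧ c ∉ cl K a ∧ c ∉ cl K b} := by
  rw [PrW_glue_sum p hdisj]
  simp only [PrW_eq_sum_ind, Finset.sum_mul_sum]
  refine Finset.sum_congr rfl fun S₁ hS₁ => Finset.sum_congr rfl fun S₂ hS₂ => ?_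
  rw [Finset.mem_powerset] at hS₁ hS₂
  rw [glued_ind_zero S₁ S₂ a b c (fun v h1 h2 => hsep v (h1.imp fun e he => ⟨hS₁ he.1, he.2⟩) (h2.imp fun e he => ⟨hS₂ he.1, he.2⟩))]
  ring

/-- **Union lemma, cell `ab|c`.**  For disjoint edge sets `D₁, D₂` glued only at the terminals, the `ab|c`-cell of `(a; b, c)` on
`D₁ ∪ D₂` is the apex piece-union polynomial of the pieces' cells (3 product(s)). [folklore] -/
theorem glued_cell_ab (p : Sym2 V → ℝ) (D₁ D₂ : Finset (Sym2 V)) (hdisj : Disjoint D₁ D₂) (a b c : V)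
    (hsep : ∀ v : V, (∃ e ∈ D₁, v ∈ e) → (∃ e ∈ D₂, v ∈ e) → (v = a ∨ v = b ∨ v = c)) :
    PrW (D₁ ∪ D₂) p {K : Finset (Sym2 V) | b ∈ cl K a ∧ c ∉ cl K a}
      = PrW D₁ p {K : Finset (Sym2 V) | b ∉ cl K a ∧ c ∉ cl K a ∧ c ∉ cl K b} * PrW D₂ p {K : Finset (Sym2 V) | b ∈ cl K a ∧ c ∉ cl K a} + PrW D₁ p {K : Finset (Sym2 V) | b ∈ cl K a ∧ c ∉ cl K a} * PrW D₂ p {K : Finset (Sym2 V) | b ∉ cl K a ∧ c ∉ cl K a ∧ c ∉ cl K b} + PrW D₁ p {K : Finset (Sym2 V) | b ∈ cl K a ∧ c ∉ cl K a} * PrW D₂ p {K : Finset (Sym2 V) | b ∈ cl K a ∧ c ∉ cl K a} := by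
  rw [PrW_glue_sum p hdisj]
  simp only [PrW_eq_sum_ind, Finset.sum_mul_sum, ← Finset.sum_add_distrib]
  refine Finset.sum_congr rfl fun S₁ hS₁ => Finset.sum_congr rfl fun S₂ hS₂ => ?_
  rw [Finset.mem_powerset] at hS₁ hS₂
  rw [glued_ind_ab S₁ S₂ a b c (fun v h1 h2 => hsep v (h1.imp fun e he => ⟨hS₁ he.1, he.2⟩) (h2.imp fun e he => ⟨hS₂ he.1, he.2⟩))]
  ring

/-- **Union lemma, cell `ac|b`.**  For disjoint edge sets `D₁, D₂` glued only at the terminals, the `ac|b`-cell of `(a; b, c)` on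
`D₁ ∪ D₂` is the apex piece-union polynomial of the pieces' cells (3 product(s)). [folklore] -/
theorem glued_cell_ac (p : Sym2 V → ℝ) (D₁ D₂ : Finset (Sym2 V)) (hdisj : Disjoint D₁ D₂) (a b c : V)
    (hsep : ∀ v : V, (∃ e ∈ D₁, v ∈ e) → (∃ e ∈ D₂, v ∈ e) → (v = a ∨ v = b ∨ v = c)) :
    PrW (D₁ ∪ D₂) p {K : Finset (Sym2 V) | c ∈ cl K a ∧ b ∉ cl K a}
      = PrW D₁ p {K : Finset (Sym2 V) | b ∉ cl K a ∧ c ∉ cl K a ∧ c ∉ cl K b} * PrW D₂ p {K : Finset (Sym2 V) | c ∈ cl K a ∧ b ∉ cl K a} + PrW D₁ p {K : Finset (Sym2 V) | c ∈ cl K a ∧ b ∉ cl K a} * PrW D₂ p {K : Finset (Sym2 V) | b ∉ cl K a ∧ c ∉ cl K a ∧ c ∉ cl K b} + PrW D₁ p {K : Finset (Sym2 V) | c ∈ cl K a ∧ b ∉ cl K a} * PrW D₂ p {K : Finset (Sym2 V) | c ∈ cl K a ∧ b ∉ cl K a} := by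
  rw [PrW_glue_sum p hdisj]
  simp only [PrW_eq_sum_ind, Finset.sum_mul_sum, ← Finset.sum_add_distrib]
  refine Finset.sum_congr rfl fun S₁ hS₁ => Finset.sum_congr rfl fun S₂ hS₂ => ?_
  rw [Finset.mem_powerset] at hS₁ hS₂
  rw [glued_ind_ac S₁ S₂ a b c (fun v h1 h2 => hsep v (h1.imp fun e he => ⟨hS₁ he.1, he.2⟩) (h2.imp fun e he => ⟨hS₂ he.1, he.2⟩))]
  ring

/-- **Union lemma, cell `a|bc`.**  For disjoint edge sets `D₁, D₂` glued only at the terminals, the `a|bc`-cell of `(a; b, c)` on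
`D₁ ∪ D₂` is the apex piece-union polynomial of the pieces' cells (3 product(s)). [folklore] -/
theorem glued_cell_bc (p : Sym2 V → ℝ) (D₁ D₂ : Finset (Sym2 V)) (hdisj : Disjoint D₁ D₂) (a b c : V)
    (hsep : ∀ v : V, (∃ e ∈ D₁, v ∈ e) → (∃ e ∈ D₂, v ∈ e) → (v = a ∨ v = b ∨ v = c)) :
    PrW (D₁ ∪ D₂) p {K : Finset (Sym2 V) | b ∉ cl K a ∧ c ∉ cl K a ∧ c ∈ cl K b}
      = PrW D₁ p {K : Finset (Sym2 V) | b ∉ cl K a ∧ c ∉ cl K a ∧ c ∉ cl K b} * PrW D₂ p {K : Finset (Sym2 V) | b ∉ cl K a ∧ c ∉ cl K a ∧ c ∈ cl K b} + PrW D₁ p {K : Finset (Sym2 V) | b ∉ cl K a ∧ c ∉ cl K a ∧ c ∈ cl K b} * PrW D₂ p {K : Finset (Sym2 V) | b ∉ cl K a ∧ c ∉ cl K a ∧ c ∉ cl K b} + PrW D₁ p {K : Finset (Sym2 V) | b ∉ cl K a ∧ c ∉ cl K a ∧ c ∈ cl K b} * PrW D₂ p {K : Finset (Sym2 V) | b ∉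 cl K a ∧ c ∉ cl K a ∧ c ∈ cl K b} := by
  rw [PrW_glue_sum p hdisj]
  simp only [PrW_eq_sum_ind, Finset.sum_mul_sum, ← Finset.sum_add_distrib]
  refine Finset.sum_congr rfl fun S₁ hS₁ => Finset.sum_congr rfl fun S₂ hS₂ => ?_
  rw [Finset.mem_powerset] at hS₁ hS₂
  rw [glued_ind_bc S₁ S₂ a b c (fun v h1 h2 => hsep v (h1.imp fun e he => ⟨hS₁ he.1, he.2⟩) (h2.imp fun e he => ⟨hS₂ he.1, he.2⟩))]
  ring

/-- **Union lemma, cell `abc`.**  For disjoint edge sets `D₁, D₂` glued only at the terminals, the `abc`-cell of `(a; b, c)` on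
`D₁ ∪ D₂` is the apex piece-union polynomial of the pieces' cells (15 product(s)). [folklore] -/
theorem glued_cell_three (p : Sym2 V → ℝ) (D₁ D₂ : Finset (Sym2 V)) (hdisj : Disjoint D₁ D₂) (a b c : V)
    (hsep : ∀ v : V, (∃ e ∈ D₁, v ∈ e) → (∃ e ∈ D₂, v ∈ e) → (v = a ∨ v = b ∨ v = c)) :
    PrW (D₁ ∪ D₂) p {K : Finset (Sym2 V) | b ∈ cl K a ∧ c ∈ cl K a}
      = PrW D₁ p {K : Finset (Sym2 V) | b ∉ cl K a ∧ c ∉ cl K a ∧ c ∉ cl K b} * PrW D₂ p {K : Finset (Sym2 V) | b ∈ cl K a ∧ c ∈ cl K a} + PrW D₁ p {K : Finset (Sym2 V) | b ∈ cl K a ∧ c ∉ cl K a} * PrW D₂ p {K : Finset (Sym2 V) | c ∈ cl K a ∧ b ∉ cl K a} + PrW D₁ p {K : Finset (Sym2 V) | b ∈ cl K a ∧ c ∉ cl K a} * PrW D₂ p {K : Finset (Sym2 V) | b ∉ cl K a ∧ c ∉ cl K a ∧ c ∈ cl K b} + PrW D₁ p {K : Finset (Sym2 V) | b ∈ cl K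 a ∧ c ∉ cl K a} * PrW D₂ p {K : Finset (Sym2 V) | b ∈ cl K a ∧ c ∈ cl K a} + PrW D₁ p {K : Finset (Sym2 V) | c ∈ cl K a ∧ b ∉ cl K a} * PrW D₂ p {K : Finset (Sym2 V) | b ∈ cl K a ∧ c ∉ cl K a} + PrW D₁ p {K : Finset (Sym2 V) | c ∈ cl K a ∧ b ∉ cl K a} * PrW D₂ p {K : Finset (Sym2 V) | b ∉ cl K a ∧ c ∉ cl K a ∧ c ∈ cl K b} + PrW D₁ p {K : Finset (Sym2 V) | c ∈ cl K a ∧ b ∉ cl K a} * PrW D₂ p {K : Finset (Sym2 V) | b ∈ cl K a ∧ c ∈ cl K a} + PrW D₁ p {K : Finset (Sym2 V) | b ∉ cl K a ∧ c ∉ cl K a ∧ c ∈ cl K b} * PrW D₂ p {K : Finset (Sym2 V) | b ∈ cl K a ∧ c ∉ cl K a} + PrW D₁ p {K : Finset (Sym2 V) | b ∉ cl K a ∧ c ∉ cl K a ∧ c ∈ cl K b} * PrW D₂ p {K : Finset (Sym2 V) | c ∈ cl K a ∧ b ∉ cl K a} + PrW D₁ p {K : Finset (Sym2 V) | b ∉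 cl K a ∧ c ∉ cl K a ∧ c ∈ cl K b} * PrW D₂ p {K : Finset (Sym2 V) | b ∈ cl K a ∧ c ∈ cl K a} + PrW D₁ p {K : Finset (Sym2 V) | b ∈ cl K a ∧ c ∈ cl K a} * PrW D₂ p {K : Finset (Sym2 V) | b ∉ cl K a ∧ c ∉ cl K a ∧ c ∉ cl K b} + PrW D₁ p {K : Finset (Sym2 V) | b ∈ cl K a ∧ c ∈ cl K a} * PrW D₂ p {K : Finset (Sym2 V) | b ∈ cl K a ∧ c ∉ cl K a} + PrW D₁ p {K : Finset (Sym2 V) | b ∈ cl K a ∧ c ∈ cl K a} * PrW D₂ p {K : Finset (Sym2 V) | c ∈ cl K a ∧ b ∉ cl K a} + PrW D₁ p {K : Finset (Sym2 V) | b ∈ cl K a ∧ c ∈ cl K a} * PrW D₂ p {K : Finset (Sym2 V) | b ∉ cl K a ∧ c ∉ cl K a ∧ c ∈ cl K b} + PrW D₁ p {K : Finset (Sym2 V) | b ∈ cl K a ∧ c ∈ cl K a} * PrW D₂ p {K : Finset (Sym2 V) | b ∈ cl K a ∧ c ∈ cl K a} := by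
  rw [PrW_glue_sum p hdisj]
  simp only [PrW_eq_sum_ind, Finset.sum_mul_sum, ← Finset.sum_add_distrib]
  refine Finset.sum_congr rfl fun S₁ hS₁ => Finset.sum_congr rfl fun S₂ hS₂ => ?_
  rw [Finset.mem_powerset] at hS₁ hS₂
  rw [glued_ind_three S₁ S₂ a b c (fun v h1 h2 => hsep v (h1.imp fun e he => ⟨hS₁ he.1, he.2⟩) (h2.imp fun e he => ⟨hS₂ he.1, he.2⟩))]
  ring

end APL

end Summit.CriticalPhenomena.PercolationContinuityZ3.Theorems
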